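import Literature.RepresentationTheory.KonnoKonno2007.JunctionSqueezedVacuum
import Literature.NumberTheory.Weil1964.ArchVacuumSection
import Mathlib.Analysis.CStarAlgebra.Matrix
import HarnessLib

/-!
# The vacuum overlap `⟪k₀, hypOp t ∘ μ₀(U) ∘ hypOp s k₀⟫` of the rank-one junction is a geometric series
(kernel, 0 records)

Topic `RepresentationTheory/KonnoKonno2007`; namespace `Literature.RepresentationTheory.KonnoKonno2007.RealDualPair`.
Continuation of `JunctionSqueezedVacuum` (the squeezed vacuum `hypOp s h₀ = Σ_n (−i)^n sech s tanh^n s · h_{nd}` of the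
rank-one junction `U(P,Q) × U(R,∅)`, `[Unique R] [IsEmpty S]`, plane `(p₀,q₀)`).  For a unitary `U` of the `𝕎`-coordinates
`DPIdx P Q R S` whose `(k', k)` entry vanishes (`k = (p₀,r₀) ∈ V⁺⊗W`, `k' = (q₀,r₀) ∈ V⁻⊗W`; every block datum `dualPairι k`
of the compact dual pair qualifies, `dualPairι_idxQ_idxP`) put `χ(U) := (U*)_{kk} (U*)_{k'k'}` (`ladderChar`).  Then Folland's
`μ₀(U)` (`unitaryOpPi U`, `schrodingerU U`; Folland 1989 Prop. (4.39)) is DIAGONAL ON THE LADDER,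
`⟪h_{md}, μ₀(U) h_{nd}⟫ = δ_{mn} χ(U)^n` (`uKernel_nsmul_sqStep`, from `inner_fockToL2_zeta_linSubst_zeta_nsmul` of
`JunctionSqueezeLadder`), and summing the geometric series (`|χ(U)| ≤ 1`, `|tanh t tanh s| < 1`):

      ⟪hypOp t h₀, μ₀(U) hypOp s h₀⟫_{L²} = sech t · sech s · (1 − χ(U) tanh t tanh s)⁻¹      (`inner_toL2_hypOp_schrodingerU_toL2_hypOp`)
      ⟪k₀, hypOp t (μ₀(U) (hypOp s h₀))⟫_{L²} = sech t · sech s · (1 + χ(U) tanh t tanh s)⁻¹    (`inner_vacL2_toL2_hypOp_unitaryOpPi_hypOp`)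

(the second from the first at `−t`: `hypOp t` is `L²`-unitary with inverse `hypOp (−t)`).  For the block datum
`k = ((a,b),(c,d))` of `U(P)×U(Q)×U(R)×U(S)` one has `χ(dualPairι k) = a_{p₀p₀} · conj(b_{q₀q₀})` (`ladderChar_dualPairι`; the
`U(R)`-phase `c` cancels).  §3–§4 restate this in the tree's `vacCoeffS` / `vnormS` currency (`Weil1964/ArchVacuumSection`):
`vacCoeffS (hypOp t) = sech t` (`vacCoeffS_hypOp_eq`; `vnormS (hypOp t) = hypOp t` is the tree's `vnormS_hypOp`), the value
`vacCoeffS (hypOp t ∘ μ₀(U) ∘ hypOp s)` (`vacCoeffS_hypOp_comp_unitaryOpPi_comp_hypOp`, `…_dualPairι_…`), its non-vanishing, and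
THE SCHUR SCALAR of the composite,

      ‖v‖ / v = (1 + χ(U) tanh t tanh s) / |1 + χ(U) tanh t tanh s|,   v = vacCoeffS (hypOp t ∘ μ₀(U) ∘ hypOp s)

(`norm_div_vacCoeffS_hypOp_comp_unitaryOpPi_comp_hypOp`, `norm_div_vacCoeffS_hypOp_comp_dualPairι_comp_hypOp`) — the
vacuum-overlap phase identity entering the multiplicativity of a linearised archimedean Weil datum on the rank-one junction
(Konno–Konno 2007 §3; it is consumed as the hypothesis of that linearisation, elsewhere).

BOUNDARY.  Everything here is PROVED over the landed junction / Fock-model files; no statement of print is used as a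
hypothesis and no record (`def … : Prop`) is introduced; `[cite:]` tags are reader pointers, not records.

## Main results
* `ladderChar`, `norm_ladderChar_le_one`, `ladderChar_dualPairι`, `dualPairι_idxQ_idxP`;
* `uKernel_nsmul_sqStep`, `hasSum_sqCoeff_smul_hermiteL2`, `inner_hermiteL2_schrodingerU_toL2_hypOp`, `hasSum_vacuumOverlap`;
* `inner_toL2_hypOp_schrodingerU_toL2_hypOp`, `inner_vacL2_toL2_hypOp_unitaryOpPi_hypOp`, `inner_vacL2_toL2_hypOp_dualPairι_hypOp`;
* `vacCoeffS_hypOp_eq`, `vacCoeffS_hypOp_comp_unitaryOpPi_comp_hypOp` (`_ne_zero`),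
  `norm_div_vacCoeffS_hypOp_comp_unitaryOpPi_comp_hypOp`, `norm_div_vacCoeffS_hypOp_comp_dualPairι_comp_hypOp`,
  `vacCoeffS_hypOp_comp_dualPairι_comp_hypOp`.

## References
* [Folland1989] G. B. Folland, *Harmonic Analysis in Phase Space* (1989), §1.7 (1.82), Prop. (4.39), §4.2 p. 156 (the Schur
  remark).
* [KonnoKonno2007] K. Konno, T. Konno, Kyushu J. Math. 61 (2007) §2–§3.1 (doi:10.2206/kyushujm.61.35) — conventions only,
  nothing cited as a fact.
-/

set_option autoImplicit false

noncomputable section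

open Matrix Complex MeasureTheory Filter MvPolynomial
open scoped Topology Real InnerProductSpace ComplexConjugate BigOperators

namespace Literature.RepresentationTheory.KonnoKonno2007

namespace RealDualPair

open Literature.Analysis.SegalBargmann

local notation "SR" σ => SchwartzMap (σ → ℝ) ℂ
local notation "L2R" σ => Lp ℂ 2 (volume : Measure (σ → ℝ))

/-! ## §1  The ladder character `χ(U)` and the ladder block of `μ₀(U)` -/

section Overlap

variable {P Q : Type*} (R S : Type*) (p₀ : P) (q₀ : Q)
variable [Fintype P] [DecidableEq P] [Fintype Q] [DecidableEq Q] [Fintype R] [DecidableEq R] [Fintype S]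
  [DecidableEq S] [Unique R] [IsEmpty S]

attribute [local instance 10000] InnerProductSpace.toInner

/-- **the ladder character** of a unitary `U` of the `𝕎`-coordinates: `χ(U) := (U*)_{kk} (U*)_{k'k'}`,
`k = (p₀,r₀) ∈ V⁺⊗W`, `k' = (q₀,r₀) ∈ V⁻⊗W`. [folklore] -/
def ladderChar (U : Matrix.unitaryGroup (DPIdx P Q R S) ℂ) : ℂ :=
  (star (U : Matrix (DPIdx P Q R S) (DPIdx P Q R S) ℂ)) (idxP R S p₀ default) (idxP R S p₀ default) *
    (star (U : Matrix (DPIdx P Q R S) (DPIdx P Q R S) ℂ)) (idxQ R S q₀ default) (idxQ R S q₀ default)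

omit [IsEmpty S] in
/-- `|χ(U)| ≤ 1`. [folklore] -/
theorem norm_ladderChar_le_one (U : Matrix.unitaryGroup (DPIdx P Q R S) ℂ) :
    ‖ladderChar R S p₀ q₀ U‖ ≤ 1 := by
  rw [ladderChar, norm_mul, Matrix.star_apply, Matrix.star_apply, norm_star, norm_star]
  have h1 := entry_norm_bound_of_unitary U.2 (idxP R S p₀ (default : R)) (idxP R S p₀ (default : R))
  have h2 := entry_norm_bound_of_unitary U.2 (idxQ R S q₀ (default : R)) (idxQ R S q₀ (default : R))
  exact (mul_le_mul h1 h2 (norm_nonneg _) zero_le_one).trans (mul_one 1).le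

omit [Unique R] [IsEmpty S] in
/-- `|n d| = 2n`. [folklore] -/
theorem mdeg_nsmul_sqStep (r : R) (n : ℕ) :
    mdeg (n • sqStep R S p₀ q₀ r) = 2 * n := by
  classical
  induction n with
  | zero => rw [zero_smul, mul_zero]; exact (mdeg_eq_zero_iff _).mpr rfl
  | succ n ih =>
    rw [succ_nsmul, mdeg_add', ih, sqStep, mdeg_single_add, ← add_zero (Finsupp.single (idxQ R S q₀ r) 1),
      mdeg_single_add, (mdeg_eq_zero_iff _).mpr rfl]
    ring

omit [IsEmpty S] in
/-- **(K-b) THE LADDER BLOCK OF `μ₀(U)`**: for every unitary `U` of the `𝕎`-coordinates whose `(V⁻⊗W, V⁺⊗W)`-entry at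
the plane vanishes (every block datum `ι(k)` does), `⟪h_{m d}, μ₀(U) h_{n d}⟫ = δ_{mn} χ(U)^n`.
[cite: Folland1989, Prop (4.39), Thm (1.63)] -/
theorem uKernel_nsmul_sqStep (U : Matrix.unitaryGroup (DPIdx P Q R S) ℂ)
    (hU : (U : Matrix (DPIdx P Q R S) (DPIdx P Q R S) ℂ) (idxQ R S q₀ default) (idxP R S p₀ default) = 0) (m n : ℕ) :
    uKernel U (m • sqStep R S p₀ q₀ default) (n • sqStep R S p₀ q₀ default) =
      if m = n then ladderChar R S p₀ q₀ U ^ n else 0 := by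
  split_ifs with h
  · subst h
    have hM : (star (U : Matrix (DPIdx P Q R S) (DPIdx P Q R S) ℂ)) (idxP R S p₀ default) (idxQ R S q₀ default) = 0 := by
      rw [Matrix.star_apply, hU, star_zero]
    rw [uKernel, ← toL2_hermitePi, ← toL2_unitaryOpPi, toL2_hermitePi, ← piCoeffCLM_eq_inner, ← binvPi_zeta,
      unitaryOpPi_binvPi, piCoeffCLM_binvPi]
    exact inner_fockToL2_zeta_linSubst_zeta_nsmul (idxP_ne_idxQ R S p₀ q₀ default) _ hM m
  · refine uKernel_eq_zero_of_degree_ne U ?_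
    rw [degree_eq_mdeg, degree_eq_mdeg, mdeg_nsmul_sqStep, mdeg_nsmul_sqStep]
    omega

/-! ## §2  The vacuum overlap is a geometric series -/

/-- **the squeezed vacuum expands along the ladder** (in `L²`): `hypOp s h₀ = Σ_n a_{n d}(s) h_{n d}`.
[cite: Folland1989, Prop (4.39), (1.82)] -/
theorem hasSum_sqCoeff_smul_hermiteL2 (s : ℝ) :
    HasSum (fun n : ℕ => sqCoeff R S p₀ q₀ (n • sqStep R S p₀ q₀ default) s •
        (hermiteL2 (n • sqStep R S p₀ q₀ default) : L2R (DPIdx P Q R S)))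
      (toL2 (hypOp R S p₀ q₀ s (hermitePi 0))) := by
  set ψ : L2R (DPIdx P Q R S) := toL2 (hypOp R S p₀ q₀ s (hermitePi 0)) with hψ
  have h := (hermiteBasis (σ := DPIdx P Q R S)).hasSum_repr ψ
  have e : (fun β => (hermiteBasis (σ := DPIdx P Q R S)).repr ψ β • (hermiteBasis (σ := DPIdx P Q R S)) β) =
      fun β => sqCoeff R S p₀ q₀ β s • (hermiteL2 β : L2R (DPIdx P Q R S)) := by
    funext β
    rw [HilbertBasis.repr_apply_apply, hermiteBasis_apply]
    rfl
  rw [e] at h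
  exact (Function.Injective.hasSum_iff (nsmul_sqStep_injective R S p₀ q₀ default)
    (f := fun β => sqCoeff R S p₀ q₀ β s • (hermiteL2 β : L2R (DPIdx P Q R S))) fun β hβ => by
      rw [sqCoeff_eq_zero_of_ne_nsmul R S p₀ q₀ β (fun n hn => hβ ⟨n, hn.symm⟩) s, zero_smul]).mpr h

/-- `⟪h_{n d}, μ₀(U) (hypOp s h₀)⟫ = χ(U)^n a_{n d}(s)`. [cite: Folland1989, Prop (4.39), (1.82)] -/
theorem inner_hermiteL2_schrodingerU_toL2_hypOp (U : Matrix.unitaryGroup (DPIdx P Q R S) ℂ)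
    (hU : (U : Matrix (DPIdx P Q R S) (DPIdx P Q R S) ℂ) (idxQ R S q₀ default) (idxP R S p₀ default) = 0)
    (n : ℕ) (s : ℝ) :
    ⟪(hermiteL2 (n • sqStep R S p₀ q₀ default) : L2R (DPIdx P Q R S)),
        schrodingerU U (toL2 (hypOp R S p₀ q₀ s (hermitePi 0)))⟫_ℂ =
      ladderChar R S p₀ q₀ U ^ n * sqCoeff R S p₀ q₀ (n • sqStep R S p₀ q₀ default) s := by
  have h := ((hasSum_sqCoeff_smul_hermiteL2 R S p₀ q₀ s).mapL
    (((schrodingerU U).toContinuousLinearEquiv : (L2R (DPIdx P Q R S)) ≃L[ℂ] L2R (DPIdx P Q R S)) :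
      (L2R (DPIdx P Q R S)) →L[ℂ] L2R (DPIdx P Q R S))).mapL
    (innerSL ℂ (hermiteL2 (n • sqStep R S p₀ q₀ default) : L2R (DPIdx P Q R S)))
  have h' : HasSum (fun m : ℕ => ⟪(hermiteL2 (n • sqStep R S p₀ q₀ default) : L2R (DPIdx P Q R S)),
      schrodingerU U (sqCoeff R S p₀ q₀ (m • sqStep R S p₀ q₀ default) s •
        (hermiteL2 (m • sqStep R S p₀ q₀ default) : L2R (DPIdx P Q R S)))⟫_ℂ)
      ⟪(hermiteL2 (n • sqStep R S p₀ q₀ default) : L2R (DPIdx P Q R S)),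
        schrodingerU U (toL2 (hypOp R S p₀ q₀ s (hermitePi 0)))⟫_ℂ := h
  have e : ∀ m : ℕ, ⟪(hermiteL2 (n • sqStep R S p₀ q₀ default) : L2R (DPIdx P Q R S)),
      schrodingerU U (sqCoeff R S p₀ q₀ (m • sqStep R S p₀ q₀ default) s •
        (hermiteL2 (m • sqStep R S p₀ q₀ default) : L2R (DPIdx P Q R S)))⟫_ℂ =
      if m = n then ladderChar R S p₀ q₀ U ^ n * sqCoeff R S p₀ q₀ (n • sqStep R S p₀ q₀ default) s else 0 := by
    intro m
    rw [LinearIsometryEquiv.map_smul, inner_smul_right (E := L2R (DPIdx P Q R S))]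
    change _ * uKernel U (n • sqStep R S p₀ q₀ default) (m • sqStep R S p₀ q₀ default) = _
    rw [uKernel_nsmul_sqStep R S p₀ q₀ U hU n m]
    by_cases hm : m = n
    · subst hm
      rw [if_pos rfl, if_pos rfl, mul_comm]
    · rw [if_neg (Ne.symm hm), if_neg hm, mul_zero]
  simp only [e] at h'
  exact h'.unique (hasSum_ite_eq n _)

/-- the ladder series of the vacuum overlap. [cite: Folland1989, Prop (4.39), (1.82)] -/
theorem hasSum_vacuumOverlap (U : Matrix.unitaryGroup (DPIdx P Q R S) ℂ)
    (hU : (U : Matrix (DPIdx P Q R S) (DPIdx P Q R S) ℂ) (idxQ R S q₀ default) (idxP R S p₀ default) = 0)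
    (t s : ℝ) :
    HasSum (fun n : ℕ => conj (sqCoeff R S p₀ q₀ (n • sqStep R S p₀ q₀ default) t) *
        (ladderChar R S p₀ q₀ U ^ n * sqCoeff R S p₀ q₀ (n • sqStep R S p₀ q₀ default) s))
      ⟪toL2 (hypOp R S p₀ q₀ t (hermitePi 0)),
        schrodingerU U (toL2 (hypOp R S p₀ q₀ s (hermitePi 0)) : L2R (DPIdx P Q R S))⟫_ℂ := by
  have h := (hasSum_sqCoeff_smul_hermiteL2 R S p₀ q₀ t).mapL
    (innerSLFlip ℂ (schrodingerU U (toL2 (hypOp R S p₀ q₀ s (hermitePi 0))) : L2R (DPIdx P Q R S)))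
  have h' : HasSum (fun m : ℕ => ⟪sqCoeff R S p₀ q₀ (m • sqStep R S p₀ q₀ default) t •
      (hermiteL2 (m • sqStep R S p₀ q₀ default) : L2R (DPIdx P Q R S)),
        schrodingerU U (toL2 (hypOp R S p₀ q₀ s (hermitePi 0)))⟫_ℂ)
      ⟪toL2 (hypOp R S p₀ q₀ t (hermitePi 0)),
        schrodingerU U (toL2 (hypOp R S p₀ q₀ s (hermitePi 0)) : L2R (DPIdx P Q R S))⟫_ℂ := h
  simp only [inner_smul_left (E := L2R (DPIdx P Q R S)), inner_hermiteL2_schrodingerU_toL2_hypOp R S p₀ q₀ U hU] at h'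
  exact h'

/-- the `n`-th term of the overlap: `conj a_{nd}(t) · a_{nd}(s) = sech t sech s (tanh t tanh s)^n`. [folklore] -/
theorem conj_sqCoeff_mul_sqCoeff (n : ℕ) (t s : ℝ) :
    conj (sqCoeff R S p₀ q₀ (n • sqStep R S p₀ q₀ default) t) * sqCoeff R S p₀ q₀ (n • sqStep R S p₀ q₀ default) s =
      (((Real.cosh t)⁻¹ * (Real.cosh s)⁻¹ : ℝ) : ℂ) * (((Real.tanh t * Real.tanh s : ℝ) : ℂ)) ^ n := by
  rw [sqCoeff_nsmul_sqStep, sqCoeff_nsmul_sqStep, map_mul, Complex.conj_ofReal, map_pow, map_neg, Complex.conj_I,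
    neg_neg, Real.tanh_eq_sinh_div_cosh, Real.tanh_eq_sinh_div_cosh]
  have hI : I ^ n * (-I) ^ n = 1 := by rw [← mul_pow, mul_neg, Complex.I_mul_I, neg_neg, one_pow]
  simp only [Complex.ofReal_mul, Complex.ofReal_pow, Complex.ofReal_inv, Complex.ofReal_div]
  linear_combination (((Real.cosh t : ℝ) : ℂ))⁻¹ * (((Real.sinh t : ℝ) : ℂ) / ((Real.cosh t : ℝ) : ℂ)) ^ n *
    ((((Real.cosh s : ℝ) : ℂ))⁻¹ * (((Real.sinh s : ℝ) : ℂ) / ((Real.cosh s : ℝ) : ℂ)) ^ n) * hI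

omit [Fintype P] [DecidableEq P] [Fintype Q] [DecidableEq Q] [Fintype R] [DecidableEq R] [Fintype S]
  [DecidableEq S] [Unique R] [IsEmpty S] in
/-- `|tanh t · tanh s| < 1`. [folklore] -/
theorem abs_tanh_mul_tanh_lt_one (t s : ℝ) : |Real.tanh t * Real.tanh s| < 1 := by
  rw [abs_mul, Real.tanh_eq_sinh_div_cosh, Real.tanh_eq_sinh_div_cosh]
  exact mul_lt_one_of_nonneg_of_lt_one_left (abs_nonneg _) (abs_tanh_lt_one t) (abs_tanh_lt_one s).le

/-- **(K-c) THE VACUUM OVERLAP IS A GEOMETRIC SERIES**: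
`⟪hypOp t h₀, μ₀(U) hypOp s h₀⟫_{L²} = sech t · sech s / (1 − χ(U) tanh t tanh s)` for every `U ∈ U(𝕎-coords)` with
`U_{(q₀,r₀),(p₀,r₀)} = 0`. [cite: Folland1989, Prop (4.39), (1.82)] -/
theorem inner_toL2_hypOp_schrodingerU_toL2_hypOp (U : Matrix.unitaryGroup (DPIdx P Q R S) ℂ)
    (hU : (U : Matrix (DPIdx P Q R S) (DPIdx P Q R S) ℂ) (idxQ R S q₀ default) (idxP R S p₀ default) = 0)
    (t s : ℝ) :
    ⟪toL2 (hypOp R S p₀ q₀ t (hermitePi 0)),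
        schrodingerU U (toL2 (hypOp R S p₀ q₀ s (hermitePi 0)) : L2R (DPIdx P Q R S))⟫_ℂ =
      (((Real.cosh t)⁻¹ * (Real.cosh s)⁻¹ : ℝ) : ℂ) *
        (1 - ladderChar R S p₀ q₀ U * ((Real.tanh t * Real.tanh s : ℝ) : ℂ))⁻¹ := by
  have h := hasSum_vacuumOverlap R S p₀ q₀ U hU t s
  have hr : ‖ladderChar R S p₀ q₀ U * ((Real.tanh t * Real.tanh s : ℝ) : ℂ)‖ < 1 := by
    rw [norm_mul, Complex.norm_real, Real.norm_eq_abs]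
    exact (mul_le_of_le_one_left (abs_nonneg _) (norm_ladderChar_le_one R S p₀ q₀ U)).trans_lt
      (abs_tanh_mul_tanh_lt_one t s)
  have hg := (hasSum_geometric_of_norm_lt_one hr).mul_left (((Real.cosh t)⁻¹ * (Real.cosh s)⁻¹ : ℝ) : ℂ)
  refine h.unique ?_
  have e : (fun n : ℕ => conj (sqCoeff R S p₀ q₀ (n • sqStep R S p₀ q₀ default) t) *
      (ladderChar R S p₀ q₀ U ^ n * sqCoeff R S p₀ q₀ (n • sqStep R S p₀ q₀ default) s)) =
      fun n : ℕ => (((Real.cosh t)⁻¹ * (Real.cosh s)⁻¹ : ℝ) : ℂ) *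
        (ladderChar R S p₀ q₀ U * ((Real.tanh t * Real.tanh s : ℝ) : ℂ)) ^ n := by
    funext n
    rw [mul_left_comm, conj_sqCoeff_mul_sqCoeff, mul_pow, mul_left_comm]
  rw [e]
  exact hg

/-- **(K-c), vacuum-coefficient form** (the shape `vacCoeffS (hypOp t ∘ μ₀(U) ∘ hypOp s)` of the junction's Schur
cocycle): `⟪k₀, hypOp t (μ₀(U) (hypOp s h₀))⟫_{L²} = sech t · sech s / (1 + χ(U) tanh t tanh s)`.
[cite: Folland1989, Prop (4.39), (1.82)] -/
theorem inner_vacL2_toL2_hypOp_unitaryOpPi_hypOp (U : Matrix.unitaryGroup (DPIdx P Q R S) ℂ)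
    (hU : (U : Matrix (DPIdx P Q R S) (DPIdx P Q R S) ℂ) (idxQ R S q₀ default) (idxP R S p₀ default) = 0)
    (t s : ℝ) :
    ⟪(vacL2 : L2R (DPIdx P Q R S)),
        toL2 (hypOp R S p₀ q₀ t (unitaryOpPi U (hypOp R S p₀ q₀ s (hermitePi 0))))⟫_ℂ =
      (((Real.cosh t)⁻¹ * (Real.cosh s)⁻¹ : ℝ) : ℂ) *
        (1 + ladderChar R S p₀ q₀ U * ((Real.tanh t * Real.tanh s : ℝ) : ℂ))⁻¹ := by
  rw [← toL2_hermitePi_zero]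
  nth_rewrite 1 [← hypOp_apply_neg R S p₀ q₀ t (hermitePi 0)]
  rw [toL2_hypOp, toL2_hypOp R S p₀ q₀ t (unitaryOpPi U _), LinearIsometryEquiv.inner_map_map, toL2_unitaryOpPi,
    inner_toL2_hypOp_schrodingerU_toL2_hypOp R S p₀ q₀ U hU (-t) s, Real.cosh_neg, Real.tanh_neg]
  push_cast
  ring

/-! ## §2b  The block datum `ι(k)` of the compact dual pair: the hypothesis holds and `χ(ι k) = a_{p₀p₀} · conj b_{q₀q₀}` -/

omit [Unique R] [IsEmpty S] in
/-- every block datum has vanishing `(V⁻⊗W, V⁺⊗W)` block. [folklore] -/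
theorem dualPairι_idxQ_idxP (k : DPK P Q R S) (r r' : R) :
    ((dualPairι k : Matrix.unitaryGroup (DPIdx P Q R S) ℂ) : Matrix (DPIdx P Q R S) (DPIdx P Q R S) ℂ)
      (idxQ R S q₀ r) (idxP R S p₀ r') = 0 := by
  rw [coe_dualPairι]
  rfl

omit [IsEmpty S] in
/-- **the ladder character of a block datum**: `χ(ι((a,b),(c,d))) = a_{p₀p₀} · conj(b_{q₀q₀})` (the `U(W)`-phase `c`
cancels). [folklore] -/
theorem ladderChar_dualPairι (k : DPK P Q R S) :
    ladderChar R S p₀ q₀ (dualPairι k) = (k.1.1 : Matrix P P ℂ) p₀ p₀ * star ((k.1.2 : Matrix Q Q ℂ) q₀ q₀) := by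
  obtain ⟨⟨a, b⟩, ⟨c, d⟩⟩ := k
  have hc : (c : Matrix R R ℂ) default default * star ((c : Matrix R R ℂ) default default) = 1 := by
    have h1 := Matrix.mem_unitaryGroup_iff.mp c.2
    have h2 := congrFun (congrFun h1 default) default
    rwa [Matrix.mul_apply, Fintype.sum_unique, Matrix.star_apply, Matrix.one_apply_eq] at h2
  rw [ladderChar, Matrix.star_apply, Matrix.star_apply, coe_dualPairι]
  simp only [idxP, idxQ, Matrix.fromBlocks_apply₁₁, Matrix.fromBlocks_apply₂₂, Matrix.map_apply,
    Matrix.kroneckerMap_apply, star_mul', star_star]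
  linear_combination ((a : Matrix P P ℂ) p₀ p₀ * star ((b : Matrix Q Q ℂ) q₀ q₀)) * hc

/-- **(K-c) for the block datum**, the shape consumed by the junction cocycle:
`⟪k₀, hypOp t (μ₀(ι k) (hypOp s h₀))⟫ = sech t sech s / (1 + a_{p₀p₀} conj(b_{q₀q₀}) tanh t tanh s)`.
[cite: Folland1989, Prop (4.39), (1.82)] -/
theorem inner_vacL2_toL2_hypOp_dualPairι_hypOp (k : DPK P Q R S) (t s : ℝ) :
    ⟪(vacL2 : L2R (DPIdx P Q R S)),
        toL2 (hypOp R S p₀ q₀ t (unitaryOpPi (dualPairι k) (hypOp R S p₀ q₀ s (hermitePi 0))))⟫_ℂ =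
      (((Real.cosh t)⁻¹ * (Real.cosh s)⁻¹ : ℝ) : ℂ) *
        (1 + (k.1.1 : Matrix P P ℂ) p₀ p₀ * star ((k.1.2 : Matrix Q Q ℂ) q₀ q₀) *
          ((Real.tanh t * Real.tanh s : ℝ) : ℂ))⁻¹ := by
  rw [inner_vacL2_toL2_hypOp_unitaryOpPi_hypOp R S p₀ q₀ (dualPairι k) (dualPairι_idxQ_idxP R S p₀ q₀ k default default),
    ladderChar_dualPairι]

/-! ## §3  The Schur scalar `‖V‖/V` of the composite (the quantity `vnormS` rescales by) -/

omit [IsEmpty S] in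
/-- `1 + χ(U) tanh t tanh s ≠ 0` (`|χ tanh t tanh s| < 1`). [folklore] -/
theorem one_add_ladderChar_mul_ne_zero (U : Matrix.unitaryGroup (DPIdx P Q R S) ℂ) (t s : ℝ) :
    (1 + ladderChar R S p₀ q₀ U * ((Real.tanh t * Real.tanh s : ℝ) : ℂ)) ≠ 0 := by
  intro h
  have hr : ‖ladderChar R S p₀ q₀ U * ((Real.tanh t * Real.tanh s : ℝ) : ℂ)‖ < 1 := by
    rw [norm_mul, Complex.norm_real, Real.norm_eq_abs]
    exact (mul_le_of_le_one_left (abs_nonneg _) (norm_ladderChar_le_one R S p₀ q₀ U)).trans_lt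
      (abs_tanh_mul_tanh_lt_one t s)
  have h1 : ladderChar R S p₀ q₀ U * ((Real.tanh t * Real.tanh s : ℝ) : ℂ) = -1 := by linear_combination h
  rw [h1, norm_neg, norm_one] at hr
  exact lt_irrefl _ hr

/-- **the vacuum overlap does not vanish.** [cite: Folland1989, Prop (4.39), (1.82)] -/
theorem inner_vacL2_toL2_hypOp_unitaryOpPi_hypOp_ne_zero (U : Matrix.unitaryGroup (DPIdx P Q R S) ℂ)
    (hU : (U : Matrix (DPIdx P Q R S) (DPIdx P Q R S) ℂ) (idxQ R S q₀ default) (idxP R S p₀ default) = 0)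
    (t s : ℝ) :
    ⟪(vacL2 : L2R (DPIdx P Q R S)),
        toL2 (hypOp R S p₀ q₀ t (unitaryOpPi U (hypOp R S p₀ q₀ s (hermitePi 0))))⟫_ℂ ≠ 0 := by
  rw [inner_vacL2_toL2_hypOp_unitaryOpPi_hypOp R S p₀ q₀ U hU]
  refine mul_ne_zero ?_ (inv_ne_zero (one_add_ladderChar_mul_ne_zero R S p₀ q₀ U t s))
  exact_mod_cast (mul_pos (inv_pos.mpr (Real.cosh_pos t)) (inv_pos.mpr (Real.cosh_pos s))).ne'

/-- **THE SCHUR SCALAR of the composite `hypOp t ∘ μ₀(U) ∘ hypOp s`**: with `V` its vacuum coefficient and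
`w := 1 + χ(U) tanh t tanh s`, `‖V‖ / V = w / |w|` — i.e. the unit phase of `V` is the INVERSE of the unit phase of
`1 + χ(U) tanh t tanh s` (the vacuum-overlap identity (★★) of the junction's linearisation, exponent `ε = −1`).
[cite: Folland1989, Prop (4.39), (1.82)] -/
theorem norm_div_inner_vacL2_toL2_hypOp_unitaryOpPi_hypOp (U : Matrix.unitaryGroup (DPIdx P Q R S) ℂ)
    (hU : (U : Matrix (DPIdx P Q R S) (DPIdx P Q R S) ℂ) (idxQ R S q₀ default) (idxP R S p₀ default) = 0)
    (t s : ℝ) :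
    ((‖⟪(vacL2 : L2R (DPIdx P Q R S)),
        toL2 (hypOp R S p₀ q₀ t (unitaryOpPi U (hypOp R S p₀ q₀ s (hermitePi 0))))⟫_ℂ‖ : ℝ) : ℂ) /
        ⟪(vacL2 : L2R (DPIdx P Q R S)),
          toL2 (hypOp R S p₀ q₀ t (unitaryOpPi U (hypOp R S p₀ q₀ s (hermitePi 0))))⟫_ℂ =
      (1 + ladderChar R S p₀ q₀ U * ((Real.tanh t * Real.tanh s : ℝ) : ℂ)) /
        ((‖1 + ladderChar R S p₀ q₀ U * ((Real.tanh t * Real.tanh s : ℝ) : ℂ)‖ : ℝ) : ℂ) := by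
  have hw := one_add_ladderChar_mul_ne_zero R S p₀ q₀ U t s
  have hc : 0 < (Real.cosh t)⁻¹ * (Real.cosh s)⁻¹ := mul_pos (inv_pos.mpr (Real.cosh_pos t)) (inv_pos.mpr (Real.cosh_pos s))
  have hc' : ((((Real.cosh t)⁻¹ * (Real.cosh s)⁻¹ : ℝ)) : ℂ) ≠ 0 := by exact_mod_cast hc.ne'
  have hnw : ((‖1 + ladderChar R S p₀ q₀ U * ((Real.tanh t * Real.tanh s : ℝ) : ℂ)‖ : ℝ) : ℂ) ≠ 0 := by
    exact_mod_cast (norm_pos_iff.mpr hw).ne'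
  rw [inner_vacL2_toL2_hypOp_unitaryOpPi_hypOp R S p₀ q₀ U hU, norm_mul, norm_inv, Complex.norm_real,
    Real.norm_of_nonneg hc.le]
  generalize ladderChar R S p₀ q₀ U = χ at hw hnw ⊢
  generalize (((Real.cosh t)⁻¹ * (Real.cosh s)⁻¹ : ℝ)) = c at hc hc' ⊢
  have hcc : (c : ℂ) ≠ 0 := hc'
  have hn : ‖1 + χ * ((Real.tanh t * Real.tanh s : ℝ) : ℂ)‖ ≠ 0 := (norm_pos_iff.mpr hw).ne'
  field_simp
  rw [Complex.ofReal_div, div_mul_cancel₀ _ hnw]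

/-- the same for the block datum `ι(k)`, `χ = a_{p₀p₀} conj(b_{q₀q₀})`. [cite: Folland1989, Prop (4.39), (1.82)] -/
theorem norm_div_inner_vacL2_toL2_hypOp_dualPairι_hypOp (k : DPK P Q R S) (t s : ℝ) :
    ((‖⟪(vacL2 : L2R (DPIdx P Q R S)),
        toL2 (hypOp R S p₀ q₀ t (unitaryOpPi (dualPairι k) (hypOp R S p₀ q₀ s (hermitePi 0))))⟫_ℂ‖ : ℝ) : ℂ) /
        ⟪(vacL2 : L2R (DPIdx P Q R S)),
          toL2 (hypOp R S p₀ q₀ t (unitaryOpPi (dualPairι k) (hypOp R S p₀ q₀ s (hermitePi 0))))⟫_ℂ =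
      (1 + (k.1.1 : Matrix P P ℂ) p₀ p₀ * star ((k.1.2 : Matrix Q Q ℂ) q₀ q₀) * ((Real.tanh t * Real.tanh s : ℝ) : ℂ)) /
        ((‖1 + (k.1.1 : Matrix P P ℂ) p₀ p₀ * star ((k.1.2 : Matrix Q Q ℂ) q₀ q₀) *
          ((Real.tanh t * Real.tanh s : ℝ) : ℂ)‖ : ℝ) : ℂ) := by
  rw [norm_div_inner_vacL2_toL2_hypOp_unitaryOpPi_hypOp R S p₀ q₀ (dualPairι k)
    (dualPairι_idxQ_idxP R S p₀ q₀ k default default), ladderChar_dualPairι]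

/-! ## §4  The same identities in the tree's `vacCoeffS` / `vnormS` currency (`Weil1964/ArchVacuumSection`) -/

section VacCoeff

open Literature.NumberTheory.Weil1964

/-- **the vacuum coefficient of the squeezing operator is `sech t`** (real, positive): `⟪k₀, hypOp t k₀⟫ = sech t`.
[cite: Folland1989, Prop (4.39), (1.82)] -/
theorem vacCoeffS_hypOp_eq (t : ℝ) :
    vacCoeffS (hypOp R S p₀ q₀ t) = (((Real.cosh t)⁻¹ : ℝ) : ℂ) := by
  have h := sqCoeff_nsmul_sqStep R S p₀ q₀ 0 t
  rw [zero_smul, pow_zero, one_mul, pow_zero, mul_one] at h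
  rw [vacCoeffS_apply, ← toL2_hermitePi_zero, toL2_hermitePi]
  exact h

/-- hence the vacuum normalisation of `hypOp t` is trivial: `‖c_t‖ / c_t = 1`. [cite: Folland1989, Prop (4.39), (1.82)] -/
theorem norm_div_vacCoeffS_hypOp (t : ℝ) :
    ((‖vacCoeffS (hypOp R S p₀ q₀ t)‖ : ℝ) : ℂ) / vacCoeffS (hypOp R S p₀ q₀ t) = 1 := by
  have hc : 0 < (Real.cosh t)⁻¹ := inv_pos.mpr (Real.cosh_pos t)
  rw [vacCoeffS_hypOp_eq, Complex.norm_real, Real.norm_of_nonneg hc.le, div_self]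
  exact_mod_cast hc.ne'

/-- **(K-c) in `vacCoeffS` currency**: `vacCoeffS (hypOp t ∘ μ₀(U) ∘ hypOp s) = sech t sech s (1 + χ(U) tanh t tanh s)⁻¹`.
[cite: Folland1989, Prop (4.39), (1.82)] -/
theorem vacCoeffS_hypOp_comp_unitaryOpPi_comp_hypOp (U : Matrix.unitaryGroup (DPIdx P Q R S) ℂ)
    (hU : (U : Matrix (DPIdx P Q R S) (DPIdx P Q R S) ℂ) (idxQ R S q₀ default) (idxP R S p₀ default) = 0)
    (t s : ℝ) :
    vacCoeffS ((hypOp R S p₀ q₀ t).comp ((unitaryOpPi U).comp (hypOp R S p₀ q₀ s))) =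
      (((Real.cosh t)⁻¹ * (Real.cosh s)⁻¹ : ℝ) : ℂ) *
        (1 + ladderChar R S p₀ q₀ U * ((Real.tanh t * Real.tanh s : ℝ) : ℂ))⁻¹ :=
  inner_vacL2_toL2_hypOp_unitaryOpPi_hypOp R S p₀ q₀ U hU t s

/-- non-vanishing. [cite: Folland1989, Prop (4.39), (1.82)] -/
theorem vacCoeffS_hypOp_comp_unitaryOpPi_comp_hypOp_ne_zero (U : Matrix.unitaryGroup (DPIdx P Q R S) ℂ)
    (hU : (U : Matrix (DPIdx P Q R S) (DPIdx P Q R S) ℂ) (idxQ R S q₀ default) (idxP R S p₀ default) = 0)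
    (t s : ℝ) :
    vacCoeffS ((hypOp R S p₀ q₀ t).comp ((unitaryOpPi U).comp (hypOp R S p₀ q₀ s))) ≠ 0 :=
  inner_vacL2_toL2_hypOp_unitaryOpPi_hypOp_ne_zero R S p₀ q₀ U hU t s

/-- **THE SCHUR SCALAR (★★)**: `‖v‖/v = w/|w|` for `v = vacCoeffS (hypOp t ∘ μ₀(U) ∘ hypOp s)`,
`w = 1 + χ(U) tanh t tanh s`. [cite: Folland1989, Prop (4.39), (1.82)] -/
theorem norm_div_vacCoeffS_hypOp_comp_unitaryOpPi_comp_hypOp (U : Matrix.unitaryGroup (DPIdx P Q R S) ℂ)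
    (hU : (U : Matrix (DPIdx P Q R S) (DPIdx P Q R S) ℂ) (idxQ R S q₀ default) (idxP R S p₀ default) = 0)
    (t s : ℝ) :
    ((‖vacCoeffS ((hypOp R S p₀ q₀ t).comp ((unitaryOpPi U).comp (hypOp R S p₀ q₀ s)))‖ : ℝ) : ℂ) /
        vacCoeffS ((hypOp R S p₀ q₀ t).comp ((unitaryOpPi U).comp (hypOp R S p₀ q₀ s))) =
      (1 + ladderChar R S p₀ q₀ U * ((Real.tanh t * Real.tanh s : ℝ) : ℂ)) /
        ((‖1 + ladderChar R S p₀ q₀ U * ((Real.tanh t * Real.tanh s : ℝ) : ℂ)‖ : ℝ) : ℂ) :=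
  norm_div_inner_vacL2_toL2_hypOp_unitaryOpPi_hypOp R S p₀ q₀ U hU t s

/-- **(★★) for the block datum of the compact dual pair**: with `κ(k) := a_{p₀p₀} · conj(b_{q₀q₀})` for
`k = ((a,b),(c,d))`, `‖v‖/v = (1 + κ(k) tanh t tanh s) / |1 + κ(k) tanh t tanh s|`,
`v = vacCoeffS (hypOp t ∘ μ₀(ι k) ∘ hypOp s)`. [cite: Folland1989, Prop (4.39), (1.82)] -/
theorem norm_div_vacCoeffS_hypOp_comp_dualPairι_comp_hypOp (k : DPK P Q R S) (t s : ℝ) :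
    ((‖vacCoeffS ((hypOp R S p₀ q₀ t).comp ((unitaryOpPi (dualPairι k)).comp (hypOp R S p₀ q₀ s)))‖ : ℝ) : ℂ) /
        vacCoeffS ((hypOp R S p₀ q₀ t).comp ((unitaryOpPi (dualPairι k)).comp (hypOp R S p₀ q₀ s))) =
      (1 + (k.1.1 : Matrix P P ℂ) p₀ p₀ * star ((k.1.2 : Matrix Q Q ℂ) q₀ q₀) * ((Real.tanh t * Real.tanh s : ℝ) : ℂ)) /
        ((‖1 + (k.1.1 : Matrix P P ℂ) p₀ p₀ * star ((k.1.2 : Matrix Q Q ℂ) q₀ q₀) *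
          ((Real.tanh t * Real.tanh s : ℝ) : ℂ)‖ : ℝ) : ℂ) :=
  norm_div_inner_vacL2_toL2_hypOp_dualPairι_hypOp R S p₀ q₀ k t s

/-- and its value. [cite: Folland1989, Prop (4.39), (1.82)] -/
theorem vacCoeffS_hypOp_comp_dualPairι_comp_hypOp (k : DPK P Q R S) (t s : ℝ) :
    vacCoeffS ((hypOp R S p₀ q₀ t).comp ((unitaryOpPi (dualPairι k)).comp (hypOp R S p₀ q₀ s))) =
      (((Real.cosh t)⁻¹ * (Real.cosh s)⁻¹ : ℝ) : ℂ) *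
        (1 + (k.1.1 : Matrix P P ℂ) p₀ p₀ * star ((k.1.2 : Matrix Q Q ℂ) q₀ q₀) *
          ((Real.tanh t * Real.tanh s : ℝ) : ℂ))⁻¹ :=
  inner_vacL2_toL2_hypOp_dualPairι_hypOp R S p₀ q₀ k t s

end VacCoeff

end Overlap

end RealDualPair

end Literature.RepresentationTheory.KonnoKonno2007
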